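/-
Copyright (c) 2026 the pub-hodgecm-mathlib formalisation cell (harness21).  Prover seat hodgecm-mathlib-LH3-p03 (g4) on line LH3 (closer stub `stub_N9`, N9 «Transf» direct
road), organ J, brick (G′-CANCEL) = LH3-plan (g3) RULINGS #8 (iii) ∕ #9 (ii): the descents of ONE Haar measure through ONE block equivalence; 2026-09-02.
-/
import Literature.MeasureTheory.Group.InvariantQuotientTransport        -- ★ `cosetCongr`, `subgroupCongrHomeomorph`, `map_cosetCongr_quotientMeasure`
import Literature.MeasureTheory.Group.InvariantQuotientProdNormalized    -- ★ `isClosed_coe_prod`, `map_quotientProdHomeomorph_quotientMeasure_prod`; brings ★ `quotientProdHomeomorph`, `prodEquiv_mk`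
import Literature.MeasureTheory.Group.InvariantQuotientPiTopFactor       -- ★ `quotientMeasure_top_univ`, `isClosed_coe_top`, `isInvInvariant_prod`
import Literature.MeasureTheory.Group.InvariantQuotientScaling           -- ★ `quotientMeasure_smul_measure`
import Literature.MeasureTheory.Group.InvariantQuotientCompactSubgroup   -- ★ `quotientMeasure_eq_inv_smul_map_mk`
import HarnessLib

/-!
# The quotient measure descended through a block equivalence `G ≃ₜ* U × K`, `T ↔ A × K`: `Ψ_* (ν_G ∕ ρ_T) = c • (ν_U ∕ ρ_A)` with the scalar PINNED by masses
(Folland, *A Course in Abstract Harmonic Analysis* (1995), §2.6 Thm. 2.49, (2.52); Deitmar–Echterhoff (2014), Thm. 1.5.3; Rogawski (1990), §4.12, §8.2)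

Topic `MeasureTheory/Group`; namespace `Literature.MeasureTheory.Group`; THEOREMS ONLY (no definition, no instance visible to importers, no named fact, no `sorry`).
Cell `pub/hodgecm-mathlib`, crux H413 (`stmt-HodgeConjecture-24833`), F0∕P3c line LH3 (closer stub `stub_N9`, DIRECT ROAD `F0_P3c_StubN9Direct`, organ J), brick
**(G′-CANCEL)** (LH3-plan (g3) RULINGS #8 (iii) ∕ #9 (ii), seat LH3-p03 (g4), 2026-09-02): the two `hmap` binders of ★ p850417 `exists_block_testFunction_chartOrbG_eventuallyEq`
(compact chart `S`, target `κ • π_* μ₀`) and of ★ p850444 `exists_block_testFunction_chartOrbG_xRay_eventuallyEq` (Cayley chart `insert w S`, target `κβ • μ₀′`, `μ₀′` the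
box-normalised quotient of the SHARED rank-one Haar measure `μ₀`, LH4-p03 (g4)'s `hlink`) are BOTH instances of one generic identity, and their scalars are pinned by ONE
mass identity each — which is what makes the descent constants `K = dt′(B′)·κ` and `Kβ = dt′(B′♯)·κβ` EQUAL (LH3-p02 (g3) ED. 3 `hasOneSidedJump_orbFamGExt_side_of_bricks_std`
reads a single `K` on both charts).

THE MATHEMATICS.  `eM : G ≃ₜ* U × K` (locally compact second countable groups), `T ≤ G` closed with `g ∈ T ↔ (eM g).1 ∈ A` (`A ≤ U` closed; so `eM(T) = A × K`),
`Ψ : G ⧸ T ≃ₜ U ⧸ A` the induced homeomorphism (`Ψ⁻¹(uA) = eM⁻¹(u, 1)T`).  For Haar measures `ν_G` (right invariant) on `G`, `ρ_T` (inversion invariant) on `T`, `ν_U` on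
`U`, `ρ_A` on `A`, and an auxiliary `ν_K` on `K`: `eM_* ν_G = m • ν_U ⊗ ν_K` and `eM_* ρ_T = d • ρ_A ⊗ ν_K` (Haar uniqueness), so by naturality (★ `map_cosetCongr_quotientMeasure`),
the product formula (★ `map_quotientProdHomeomorph_quotientMeasure_prod`: `(ν_U ⊗ ν_K) ∕ (ρ_A ⊗ ν_K) = (ν_U ∕ ρ_A) ⊗ (ν_K ∕ ν_K)`, the second factor a point of mass one,
★ `quotientMeasure_top_univ`) and the two scalings (★ `quotientMeasure_smul_measure`, the torus-side twin proved here):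
  **`Ψ_* (ν_G ∕ ρ_T) = c • (ν_U ∕ ρ_A)`, `c = m ∕ d`**, and `c` is PINNED by **`c · ρ_T{t ∣ (eM t).1 ∈ E′, (eM t).2 ∈ F} · ν_U(E) = ν_G(eM⁻¹(E × F)) · ρ_A(E′)`** for all
sets `E ⊆ U`, `E′ ⊆ U`, `F ⊆ K` (both sides equal `m · ρ_A(E′) · ν_K(F) · ν_U(E)`; the auxiliary `ν_K` and both Haar scalars have disappeared).
* §1 two private transports (Haar ∕ inversion invariance along `subgroupCongrHomeomorph`, right invariance along a group isomorphism), the torus-side scaling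
  `quotientMeasure_eq_inv_smul_of_smul_left` and the identification `Ψ = pr₁ ∘ quotientProdHomeomorph ∘ cosetCongr eM` (`map_block_eq_fst`).
* §2 **`exists_smul_map_block_quotientMeasure`** (the identity + the pinning clause), **`exists_smul_map_mk_of_block_compact`** (`A` compact: target `κ • π_* ν_U`, pinning
  `κ · ρ_T{(eM t).2 ∈ F} · ν_U(E) = ν_G(eM⁻¹(E × F))` — the shape of ★ p850417's `hmap`), **`exists_smul_eq_of_block_boxNormalised`** (target `κ • μ′` for ANY `μ′ = ρ_A(E₀) • (ν_U ∕ ρ_A)`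
  — LH4-p03's `hlink` shape of `μ₀′`, ★ p850444's `hmapβ`; pinning `κ · ρ_T{(eM t).1 ∈ E₀, (eM t).2 ∈ F} · ν_U(E) = ν_G(eM⁻¹(E × F))`).
* §3 **`toReal_mul_eq_toReal_mul_of_pinning`**: two descents of the SAME `ν_G` through the SAME `eM` whose boxes have the SAME `K`-shadow `F` have the same descent constant
  `ρ_{T₁}(B₁) · κ₁ = ρ_{T₂}(B₂) · κ₂` — organ J's `K = Kβ` (LH3-p02 (g3) ED. 3), three lines of arithmetic over the two pinning clauses.
HONEST LABEL: pure measure theory over ★ `InvariantQuotient*`; HC_CM is proved only modulo the 7 printed citations (2 remaining: hLiu418 = `stmt-HodgeConjecture-24832`, h413 =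
`stmt-HodgeConjecture-24833`) until rung 0 closes; this file pays nothing by itself (the LH3 dress binds ★ (M-UNFOLD) p850446∕p850477, ★ (B-STD) p850476 by name).

## References
* [Folland1995] G. B. Folland, *A Course in Abstract Harmonic Analysis* (1995), §2.2 (uniqueness of Haar measure), §2.6 Thm. 2.49, (2.52) (quotient measures, products).
* [DeitmarEchterhoff2014] A. Deitmar, S. Echterhoff, *Principles of Harmonic Analysis*, 2nd ed. (2014), Thm. 1.5.3, Cor. 1.5.4.
* [Rogawski1990] J. D. Rogawski, *Automorphic Representations of Unitary Groups in Three Variables*, Ann. of Math. Stud. 123 (1990), §4.12 Lemma 4.12.1 p. 66 (descent to the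
  centraliser `M = U(1,1) × …`), §8.2 pp. 119–124 (the same `U(1,1)`-block read on the compact and on the Cayley chart).
-/

set_option autoImplicit false

noncomputable section

open MeasureTheory MeasureTheory.Measure Topology
open scoped NNReal ENNReal

namespace Literature.MeasureTheory.Group

/-! ### §1 Helpers -/

section Helpers

variable {G G' : Type*} [Group G] [Group G'] [TopologicalSpace G] [TopologicalSpace G']
  [IsTopologicalGroup G] [IsTopologicalGroup G'] [MeasurableSpace G] [BorelSpace G] [MeasurableSpace G'] [BorelSpace G']
  (e : G ≃* G') (he : Continuous e) (hes : Continuous e.symm)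
  (H : Subgroup G) (H' : Subgroup G') (hHH' : ∀ g, e g ∈ H' ↔ g ∈ H)

/-- A Haar measure on `H` transported along the restriction `H ≃ₜ H′` of `e` (★ `subgroupCongrHomeomorph`) is a Haar measure (Mathlib `MulEquiv.isHaarMeasure_map`). [folklore] -/
private theorem isHaarMeasure_map_subgroupCongrHomeomorph₄ [LocallyCompactSpace H] (ρ : Measure H) [IsHaarMeasure ρ] :
    IsHaarMeasure (Measure.map (subgroupCongrHomeomorph e H H' hHH' he hes) ρ) := by
  let f : H ≃* H' :=
    { toFun := fun h => ⟨e h, (hHH' h).2 h.2⟩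
      invFun := fun h' => ⟨e.symm h', (forall_symm_mem_iff e H H' hHH' h').2 h'.2⟩
      left_inv := fun h => Subtype.ext (e.symm_apply_apply h)
      right_inv := fun h' => Subtype.ext (e.apply_symm_apply h')
      map_mul' := fun a b => Subtype.ext (by simp only [Subgroup.coe_mul, map_mul]) }
  have hf : ⇑f = ⇑(subgroupCongrHomeomorph e H H' hHH' he hes) := rfl
  have h := MulEquiv.isHaarMeasure_map ρ f (hf ▸ (subgroupCongrHomeomorph e H H' hHH' he hes).continuous)
    (by
      have : ⇑f.symm = ⇑(subgroupCongrHomeomorph e H H' hHH' he hes).symm := rfl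
      rw [this]; exact (subgroupCongrHomeomorph e H H' hHH' he hes).symm.continuous)
  rwa [hf] at h

/-- … and inversion invariant when `ρ` is. [folklore] -/
private theorem isInvInvariant_map_subgroupCongrHomeomorph₄ (ρ : Measure H) [ρ.IsInvInvariant] :
    (Measure.map (subgroupCongrHomeomorph e H H' hHH' he hes) ρ).IsInvInvariant := by
  let f : H ≃* H' :=
    { toFun := fun h => ⟨e h, (hHH' h).2 h.2⟩
      invFun := fun h' => ⟨e.symm h', (forall_symm_mem_iff e H H' hHH' h').2 h'.2⟩
      left_inv := fun h => Subtype.ext (e.symm_apply_apply h)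
      right_inv := fun h' => Subtype.ext (e.apply_symm_apply h')
      map_mul' := fun a b => Subtype.ext (by simp only [Subgroup.coe_mul, map_mul]) }
  have hf : ⇑f = ⇑(subgroupCongrHomeomorph e H H' hHH' he hes) := rfl
  have h := isInvInvariant_map_mulEquiv f (hf ▸ (subgroupCongrHomeomorph e H H' hHH' he hes).continuous.measurable) ρ
  rwa [hf] at h

omit [TopologicalSpace G] [TopologicalSpace G'] [IsTopologicalGroup G] [IsTopologicalGroup G'] [BorelSpace G] [BorelSpace G'] in
/-- The image of a right-invariant measure under a (measurable) group isomorphism is right invariant (the mirror of Mathlib `isMulLeftInvariant_map`). [folklore] -/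
private theorem isMulRightInvariant_map_mulEquiv [MeasurableMul G] [MeasurableMul G'] (hem : Measurable e) (μ : Measure G) [μ.IsMulRightInvariant] :
    (Measure.map e μ).IsMulRightInvariant := by
  refine ⟨fun b => ?_⟩
  rw [Measure.map_map (measurable_mul_const b) hem]
  obtain ⟨a, rfl⟩ := e.surjective b
  conv_rhs => rw [← map_mul_right_eq_self μ a]
  rw [Measure.map_map hem (measurable_mul_const a)]
  congr 1
  ext x
  simp only [Function.comp_apply, map_mul]

end Helpers

section Scaling

variable {G : Type*} [Group G] [TopologicalSpace G] [IsTopologicalGroup G] [LocallyCompactSpace G] [SecondCountableTopology G] [T2Space G]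
  [MeasurableSpace G] [BorelSpace G]
  (H : Subgroup G) (hH : IsClosed (H : Set G)) [MeasurableSpace (G ⧸ H)] [BorelSpace (G ⧸ H)]

omit [LocallyCompactSpace G] [SecondCountableTopology G] [T2Space G] [MeasurableSpace (G ⧸ H)] [BorelSpace (G ⧸ H)] in
/-- Fibre integrals scale with the fibre measure (`ρ₂ = κ • ρ₁ ⇒ f^{ρ₂} = κ · f^{ρ₁}`). [cite: Folland1995, §2.6 (2.52)] -/
private theorem fiberLIntegral_eq_mul_of_eq_smul (ρ₁ ρ₂ : Measure H) [ρ₁.IsMulLeftInvariant] [ρ₂.IsMulLeftInvariant] {κ : ℝ≥0} (h : ρ₂ = κ • ρ₁)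
    (f : G → ℝ≥0∞) (x : G ⧸ H) : fiberLIntegral H ρ₂ f x = κ * fiberLIntegral H ρ₁ f x := by
  induction x using QuotientGroup.induction_on with
  | H g => rw [fiberLIntegral_mk, fiberLIntegral_mk, h, lintegral_smul_measure, ENNReal.smul_def, smul_eq_mul]

/-- **The quotient measure scales inversely with the fibre Haar measure**: `ρ₂ = κ • ρ₁` (`κ ≠ 0`) ⇒ `ν ∕ ρ₂ = κ⁻¹ • (ν ∕ ρ₁)` (Weil's formula with constant one for `ρ₂` against
the unfolding identity for `ρ₁`, on the indicator of a positive compact; the generic statement behind ★ `quotientMeasure_eq_inv_smul_of_eq_smul` of the chart-torus file).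
[cite: DeitmarEchterhoff2014, Thm. 1.5.3] [cite: Folland1995, §2.6 Thm. 2.49, (2.52)] -/
theorem quotientMeasure_eq_inv_smul_of_smul_left (ρ₁ ρ₂ : Measure H) [ρ₁.IsHaarMeasure] [ρ₁.IsInvInvariant] [ρ₂.IsHaarMeasure] [ρ₂.IsInvInvariant]
    (ν : Measure G) [ν.IsHaarMeasure] [ν.IsMulRightInvariant] {κ : ℝ≥0} (hκ : κ ≠ 0) (h : ρ₂ = κ • ρ₁) :
    quotientMeasure H ρ₂ hH ν = κ⁻¹ • quotientMeasure H ρ₁ hH ν := by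
  haveI : IsClosed (H : Set G) := hH
  haveI : LocallyCompactSpace H := hH.isClosedEmbedding_subtypeVal.locallyCompactSpace
  have hQ := eq_unfoldingConstant_smul_quotientMeasure H ρ₁ ν (quotientMeasure H ρ₂ hH ν)
  obtain ⟨K⟩ := (inferInstance : Nonempty (TopologicalSpace.PositiveCompacts G))
  have hKpos : 0 < ν K := measure_pos_of_nonempty_interior ν K.interior_nonempty
  have hKfin : ν K < ⊤ := K.isCompact.measure_lt_top
  have hmeas : Measurable ((K : Set G).indicator (1 : G → ℝ≥0∞)) := measurable_one.indicator K.isCompact.measurableSet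
  have h1 := lintegral_fiberLIntegral_quotientMeasure H ρ₂ ν hmeas
  have h2 := lintegral_fiberLIntegral_eq_mul_lintegral H ρ₁ (quotientMeasure H ρ₂ hH ν) ν hmeas
  have hfib : fiberLIntegral H ρ₂ ((K : Set G).indicator (1 : G → ℝ≥0∞)) = fun x => κ * fiberLIntegral H ρ₁ ((K : Set G).indicator (1 : G → ℝ≥0∞)) x :=
    funext fun x => fiberLIntegral_eq_mul_of_eq_smul H ρ₁ ρ₂ h _ x
  rw [hfib, lintegral_const_mul' _ _ ENNReal.coe_ne_top, h2, lintegral_indicator_one K.isCompact.measurableSet] at h1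
  have hprod : (κ : ℝ≥0∞) * (unfoldingConstant H ρ₁ (quotientMeasure H ρ₂ hH ν) ν : ℝ≥0∞) = 1 := by
    have h3 : ((κ : ℝ≥0∞) * (unfoldingConstant H ρ₁ (quotientMeasure H ρ₂ hH ν) ν : ℝ≥0∞)) * ν K = 1 * ν K := by
      rw [one_mul, mul_assoc]; exact h1
    exact (ENNReal.mul_left_inj hKpos.ne' hKfin.ne).mp h3
  have huc : unfoldingConstant H ρ₁ (quotientMeasure H ρ₂ hH ν) ν = κ⁻¹ := by
    have h4 : (κ : ℝ≥0∞) * (unfoldingConstant H ρ₁ (quotientMeasure H ρ₂ hH ν) ν : ℝ≥0∞) = (κ : ℝ≥0∞) * (κ⁻¹ : ℝ≥0) := by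
      rw [hprod, ENNReal.coe_inv hκ, ENNReal.mul_inv_cancel (ENNReal.coe_ne_zero.mpr hκ) ENNReal.coe_ne_top]
    have h5 := (ENNReal.mul_right_inj (ENNReal.coe_ne_zero.mpr hκ) ENNReal.coe_ne_top).mp h4
    exact_mod_cast h5
  rw [huc] at hQ
  exact hQ

/-- The `ν`-argument of ★ `quotientMeasure` may be replaced by an equal measure (the instance arguments are propositions). [folklore] -/
private theorem quotientMeasure_congr_right (ρ : Measure H) [ρ.IsMulLeftInvariant] [IsFiniteMeasureOnCompacts ρ] [ρ.IsOpenPosMeasure] [ρ.IsInvInvariant]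
    {ν₁ ν₂ : Measure G} [IsFiniteMeasureOnCompacts ν₁] [ν₁.IsMulRightInvariant] [IsFiniteMeasureOnCompacts ν₂] [ν₂.IsMulRightInvariant] (h : ν₁ = ν₂) :
    quotientMeasure H ρ hH ν₁ = quotientMeasure H ρ hH ν₂ := by
  subst h
  rfl

/-- **Both scalings at once**: `ρ₂ = d • ρ₁`, `ν₂ = m • ν₁` (`d ≠ 0`, `m ≠ 0`) ⇒ `ν₂ ∕ ρ₂ = (m ∕ d) • (ν₁ ∕ ρ₁)`. [cite: DeitmarEchterhoff2014, Thm. 1.5.3] [cite: Folland1995, §2.6 (2.52)] -/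
theorem quotientMeasure_eq_div_smul_of_eq_smul (ρ₁ ρ₂ : Measure H) [ρ₁.IsHaarMeasure] [ρ₁.IsInvInvariant] [ρ₂.IsHaarMeasure] [ρ₂.IsInvInvariant]
    (ν₁ ν₂ : Measure G) [ν₁.IsHaarMeasure] [ν₁.IsMulRightInvariant] [ν₂.IsHaarMeasure] [ν₂.IsMulRightInvariant]
    {d m : ℝ≥0} (hd : d ≠ 0) (hm : m ≠ 0) (hρ : ρ₂ = d • ρ₁) (hν : ν₂ = m • ν₁) :
    quotientMeasure H ρ₂ hH ν₂ = ((m / d : ℝ≥0) : ℝ≥0∞) • quotientMeasure H ρ₁ hH ν₁ := by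
  haveI : IsClosed (H : Set G) := hH
  have hc : (m : ℝ≥0∞) ≠ 0 := ENNReal.coe_ne_zero.mpr hm
  have hc' : (m : ℝ≥0∞) ≠ ⊤ := ENNReal.coe_ne_top
  haveI := IsHaarMeasure.smul ν₁ hc hc'
  have hν' : ν₂ = (m : ℝ≥0∞) • ν₁ := by rw [hν, ENNReal.smul_def]
  rw [quotientMeasure_congr_right H hH ρ₂ hν', quotientMeasure_smul_measure H hH ρ₂ ν₁ hc hc',
    quotientMeasure_eq_inv_smul_of_smul_left H hH ρ₁ ρ₂ ν₁ hd hρ, ENNReal.smul_def, smul_smul, ← ENNReal.coe_mul, div_eq_mul_inv]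

end Scaling

/-! ### §2 The block descent -/

section BlockMap

variable {G U K : Type*} [Group G] [Group U] [Group K]
  [TopologicalSpace G] [TopologicalSpace U] [TopologicalSpace K] [IsTopologicalGroup U] [IsTopologicalGroup K]
  (eM : G ≃ₜ* U × K) (T : Subgroup G) (A : Subgroup U) (hTA : ∀ g, g ∈ T ↔ (eM g).1 ∈ A)
  (Ψ : G ⧸ T ≃ₜ U ⧸ A) (hΨ : ∀ b : U, Ψ.symm (QuotientGroup.mk b) = QuotientGroup.mk (eM.symm (b, 1)))

include hTA hΨ in
/-- **`Ψ` IS the first projection in block coordinates**: `Ψ(gT) = (eM g).1 A` — equivalently `Ψ = pr₁ ∘ quotientProdHomeomorph A ⊤ ∘ cosetCongr eM` (the `K ⧸ ⊤`-factor is a point);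
`gT = eM⁻¹((eM g).1, 1) T` because `eM(g⁻¹ · eM⁻¹((eM g).1, 1)) = (1, (eM g).2⁻¹)` has first component in `A`. [cite: Folland1995, §2.6 (2.52)] [cite: Rogawski1990, §4.12 p. 66] -/
theorem map_block_eq_fst (hHH' : ∀ g, eM.toMulEquiv g ∈ A.prod (⊤ : Subgroup K) ↔ g ∈ T) (x : G ⧸ T) :
    Ψ x = (quotientProdHomeomorph A (⊤ : Subgroup K) (cosetCongr eM.toMulEquiv T (A.prod (⊤ : Subgroup K)) hHH' x)).1 := by
  induction x using QuotientGroup.induction_on with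
  | H g =>
    rw [cosetCongr_mk, coe_quotientProdHomeomorph, prodEquiv_mk]
    have hx : (QuotientGroup.mk g : G ⧸ T) = Ψ.symm (QuotientGroup.mk (eM g).1) := by
      rw [hΨ, QuotientGroup.eq, hTA, map_mul, map_inv, ContinuousMulEquiv.apply_symm_apply]
      change ((eM g)⁻¹ * ((eM g).1, 1)).1 ∈ A
      rw [Prod.inv_mk (eM g).1 (eM g).2, Prod.mk_mul_mk, inv_mul_cancel]
      exact A.one_mem
    rw [hx, Homeomorph.apply_symm_apply]
    rfl

end BlockMap

section Block

variable {G U K : Type*} [Group G] [Group U] [Group K]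
  [TopologicalSpace G] [TopologicalSpace U] [TopologicalSpace K]
  [IsTopologicalGroup G] [IsTopologicalGroup U] [IsTopologicalGroup K]
  [LocallyCompactSpace G] [LocallyCompactSpace U] [LocallyCompactSpace K]
  [SecondCountableTopology G] [SecondCountableTopology U] [SecondCountableTopology K]
  [T2Space G] [T2Space U] [T2Space K]
  [MeasurableSpace G] [BorelSpace G] [MeasurableSpace U] [BorelSpace U] [MeasurableSpace K] [BorelSpace K]
  (eM : G ≃ₜ* U × K)
  (T : Subgroup G) (hT : IsClosed (T : Set G)) (A : Subgroup U) (hA : IsClosed (A : Set U))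
  (hTA : ∀ g, g ∈ T ↔ (eM g).1 ∈ A)
  [MeasurableSpace (G ⧸ T)] [BorelSpace (G ⧸ T)] [MeasurableSpace (U ⧸ A)] [BorelSpace (U ⧸ A)]
  (Ψ : G ⧸ T ≃ₜ U ⧸ A) (hΨ : ∀ b : U, Ψ.symm (QuotientGroup.mk b) = QuotientGroup.mk (eM.symm (b, 1)))
  (ρT : Measure T) [ρT.IsHaarMeasure] [ρT.IsInvInvariant]
  (νG : Measure G) [νG.IsHaarMeasure] [νG.IsMulRightInvariant]
  (ρA : Measure A) [ρA.IsHaarMeasure] [ρA.IsInvInvariant]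
  (νU : Measure U) [νU.IsHaarMeasure] [νU.IsMulRightInvariant]

include hTA hΨ in
/-- **THE BLOCK DESCENT OF THE QUOTIENT MEASURE, WITH ITS SCALAR PINNED.**  `eM : G ≃ₜ* U × K`, `T ≤ G` closed with `g ∈ T ↔ (eM g).1 ∈ A` (`A ≤ U` closed), `Ψ : G ⧸ T ≃ₜ U ⧸ A`
with `Ψ⁻¹(uA) = eM⁻¹(u, 1)T`; Haar measures `ν_G` (right invariant), `ρ_T` (inversion invariant), `ν_U`, `ρ_A` (and any auxiliary `ν_K`, absent from the conclusion).  Then there is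
ONE `c > 0` with **`Ψ_* (ν_G ∕ ρ_T) = c • (ν_U ∕ ρ_A)`** and, for all sets `E, E′ ⊆ U`, `F ⊆ K`,
**`c · ρ_T{t ∣ (eM t).1 ∈ E′ ∧ (eM t).2 ∈ F} · ν_U(E) = ν_G(eM⁻¹(E × F)) · ρ_A(E′ ∩ A)`** (`ρ_A(E′ ∩ A)` spelled `ρ_A(val⁻¹ E′)`).
Proof: transport along `eM` (★ `map_cosetCongr_quotientMeasure`), `eM_* ν_G = m • ν_U ⊗ ν_K`, `eM_* ρ_T = d • ρ_A ⊗ ν_K` (uniqueness of Haar measure), both scalings, the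
product formula with constant one (★ `map_quotientProdHomeomorph_quotientMeasure_prod`) and `(ν_K ∕ ν_K)(pt) = 1` (★ `quotientMeasure_top_univ`); `c = m ∕ d`, and both sides
of the pinning identity are `m · ρ_A(E′) · ν_K(F) · ν_U(E)`. [cite: Folland1995, §2.2, §2.6 Thm. 2.49, (2.52)] [cite: DeitmarEchterhoff2014, Thm. 1.5.3] [cite: Rogawski1990, §4.12 Lemma 4.12.1 p. 66; §8.2 p. 122] -/
theorem exists_smul_map_block_quotientMeasure (νK : Measure K) [νK.IsHaarMeasure] [νK.IsMulRightInvariant] [νK.IsInvInvariant] :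
    ∃ c : ℝ≥0, c ≠ 0 ∧
      Measure.map Ψ (quotientMeasure T ρT hT νG) = c • quotientMeasure A ρA hA νU ∧
      ∀ (E E' : Set U) (F : Set K),
        (c : ℝ≥0∞) * ρT {t : T | (eM (t : G)).1 ∈ E' ∧ (eM (t : G)).2 ∈ F} * νU E =
          νG (eM ⁻¹' (E ×ˢ F)) * ρA (Subtype.val ⁻¹' E') := by
  classical
  haveI hTc : IsClosed (T : Set G) := hT
  haveI hAc : IsClosed (A : Set U) := hA
  haveI : LocallyCompactSpace T := hT.isClosedEmbedding_subtypeVal.locallyCompactSpace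
  haveI : LocallyCompactSpace A := hA.isClosedEmbedding_subtypeVal.locallyCompactSpace
  -- the group isomorphism and its continuity
  set e : G ≃* U × K := eM.toMulEquiv with he_def
  have he_apply : ∀ g, e g = eM g := fun _ => rfl
  have he : Continuous e := eM.continuous
  have hes : Continuous e.symm := eM.symm.continuous
  have hem : Measurable e := he.measurable
  -- the image subgroup `T' = A × ⊤`
  haveI hKc : IsClosed ((⊤ : Subgroup K) : Set K) := isClosed_coe_top
  have hT'c : IsClosed ((A.prod (⊤ : Subgroup K) : Subgroup (U × K)) : Set (U × K)) := isClosed_coe_prod A (⊤ : Subgroup K) hA hKc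
  haveI : IsClosed ((A.prod (⊤ : Subgroup K) : Subgroup (U × K)) : Set (U × K)) := hT'c
  haveI : LocallyCompactSpace (A.prod (⊤ : Subgroup K)) := hT'c.isClosedEmbedding_subtypeVal.locallyCompactSpace
  haveI : LocallyCompactSpace (⊤ : Subgroup K) := hKc.isClosedEmbedding_subtypeVal.locallyCompactSpace
  have hHH' : ∀ g, e g ∈ A.prod (⊤ : Subgroup K) ↔ g ∈ T := fun g => by
    rw [Subgroup.mem_prod, he_apply]
    exact ⟨fun h => (hTA g).2 h.1, fun h => ⟨(hTA g).1 h, Subgroup.mem_top _⟩⟩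
  -- Borel structures on the intermediate coset spaces
  letI : MeasurableSpace (K ⧸ (⊤ : Subgroup K)) := borel _
  haveI : BorelSpace (K ⧸ (⊤ : Subgroup K)) := ⟨rfl⟩
  letI : MeasurableSpace ((U × K) ⧸ A.prod (⊤ : Subgroup K)) := borel _
  haveI : BorelSpace ((U × K) ⧸ A.prod (⊤ : Subgroup K)) := ⟨rfl⟩
  -- (a) `ν_K` on `⊤ ≤ K`
  let eT : (⊤ : Subgroup K) ≃ₜ* K :=
    { Subgroup.topEquiv with
      continuous_toFun := continuous_subtype_val
      continuous_invFun := continuous_id.subtype_mk _ }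
  set ρK : Measure (⊤ : Subgroup K) := νK.map eT.symm with hρK_def
  haveI : ρK.IsHaarMeasure := eT.symm.isHaarMeasure_map _
  haveI : ρK.IsInvInvariant := isInvInvariant_map_mulEquiv eT.symm.toMulEquiv eT.symm.continuous.measurable _
  have hρK : Measure.map ((⊤ : Subgroup K).subtype : (⊤ : Subgroup K) → K) ρK = νK := by
    rw [hρK_def, Measure.map_map (show Measurable ((⊤ : Subgroup K).subtype : (⊤ : Subgroup K) → K) from continuous_subtype_val.measurable)
      (show Measurable (⇑eT.symm : K → (⊤ : Subgroup K)) from eT.symm.continuous.measurable)]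
    have : ((⊤ : Subgroup K).subtype : (⊤ : Subgroup K) → K) ∘ ⇑eT.symm = id := funext fun _ => rfl
    rw [this, Measure.map_id]
  have hρK_apply : ∀ F : Set K, ρK (Subtype.val ⁻¹' F) = νK F := fun F => by
    rw [hρK_def, show Measure.map (⇑eT.symm) νK = Measure.map (⇑eT.symm.toHomeomorph.toMeasurableEquiv) νK from rfl, MeasurableEquiv.map_apply]
    congr 1
  -- (b) the reference product measure on `T'`
  let ep : (A.prod (⊤ : Subgroup K)) ≃ₜ* A × (⊤ : Subgroup K) :=
    { Subgroup.prodEquiv A (⊤ : Subgroup K) with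
      continuous_toFun := ((continuous_fst.comp continuous_subtype_val).subtype_mk _).prodMk ((continuous_snd.comp continuous_subtype_val).subtype_mk _)
      continuous_invFun := ((continuous_subtype_val.comp continuous_fst).prodMk (continuous_subtype_val.comp continuous_snd)).subtype_mk _ }
  have hep : (⇑ep : _ → _) = Subgroup.prodEquiv A (⊤ : Subgroup K) := rfl
  set ρp : Measure (A.prod (⊤ : Subgroup K)) := (ρA.prod ρK).map ep.symm with hρp_def
  haveI : (ρA.prod ρK).IsInvInvariant := isInvInvariant_prod ρA ρK
  haveI : ρp.IsHaarMeasure := ep.symm.isHaarMeasure_map _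
  haveI : ρp.IsInvInvariant := isInvInvariant_map_mulEquiv ep.symm.toMulEquiv ep.symm.continuous.measurable _
  have hρp : Measure.map (Subgroup.prodEquiv A (⊤ : Subgroup K)) ρp = ρA.prod ρK := by
    rw [hρp_def, ← hep, Measure.map_map (show Measurable (⇑ep : _ → _) from ep.continuous.measurable)
      (show Measurable (⇑ep.symm : _ → _) from ep.symm.continuous.measurable)]
    have : (⇑ep : _ → _) ∘ ⇑ep.symm = id := funext fun x => ep.apply_symm_apply x
    rw [this, Measure.map_id]
  have hρp_apply : ∀ (E' : Set U) (F : Set K),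
      ρp {x : A.prod (⊤ : Subgroup K) | ((x : U × K)).1 ∈ E' ∧ ((x : U × K)).2 ∈ F} = ρA (Subtype.val ⁻¹' E') * νK F := by
    intro E' F
    rw [hρp_def, show Measure.map (⇑ep.symm) (ρA.prod ρK) = Measure.map (⇑ep.symm.toHomeomorph.toMeasurableEquiv) (ρA.prod ρK) from rfl, MeasurableEquiv.map_apply]
    have hset : ⇑ep.symm.toHomeomorph.toMeasurableEquiv ⁻¹' {x : A.prod (⊤ : Subgroup K) | ((x : U × K)).1 ∈ E' ∧ ((x : U × K)).2 ∈ F} =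
        (Subtype.val ⁻¹' E') ×ˢ (Subtype.val ⁻¹' F) := by
      ext y
      rfl
    rw [hset, Measure.prod_prod, hρK_apply]
  -- (c) the transported torus measure and its scalar against the reference
  set ρT' : Measure (A.prod (⊤ : Subgroup K)) := ρT.map (subgroupCongrHomeomorph e T _ hHH' he hes) with hρT'_def
  haveI : ρT'.IsHaarMeasure := isHaarMeasure_map_subgroupCongrHomeomorph₄ e he hes T _ hHH' ρT
  haveI : ρT'.IsInvInvariant := isInvInvariant_map_subgroupCongrHomeomorph₄ e he hes T _ hHH' ρT
  set d : ℝ≥0 := haarScalarFactor ρT' ρp with hd_def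
  have hd : ρT' = d • ρp := isMulLeftInvariant_eq_smul ρT' ρp
  have hd0 : d ≠ 0 := (haarScalarFactor_pos_of_isHaarMeasure ρT' ρp).ne'
  have hρT'_apply : ∀ (E' : Set U) (F : Set K),
      ρT {t : T | (eM (t : G)).1 ∈ E' ∧ (eM (t : G)).2 ∈ F} = d * (ρA (Subtype.val ⁻¹' E') * νK F) := by
    intro E' F
    have h1 : ρT {t : T | (eM (t : G)).1 ∈ E' ∧ (eM (t : G)).2 ∈ F} = ρT' {x : A.prod (⊤ : Subgroup K) | ((x : U × K)).1 ∈ E' ∧ ((x : U × K)).2 ∈ F} := by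
      rw [hρT'_def, ← Homeomorph.toMeasurableEquiv_coe, MeasurableEquiv.map_apply]
      congr 1
    rw [h1, hd, Measure.smul_apply, hρp_apply, ENNReal.smul_def, smul_eq_mul]
  -- (d) the transported group measure and its scalar against `ν_U ⊗ ν_K`
  set ν' : Measure (U × K) := νG.map e with hν'_def
  haveI : ν'.IsHaarMeasure := by rw [hν'_def]; exact eM.isHaarMeasure_map νG
  haveI : ν'.IsMulRightInvariant := isMulRightInvariant_map_mulEquiv e hem νG
  set m : ℝ≥0 := haarScalarFactor ν' (νU.prod νK) with hm_def
  have hm : ν' = m • νU.prod νK := isMulLeftInvariant_eq_smul ν' (νU.prod νK)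
  have hm0 : m ≠ 0 := (haarScalarFactor_pos_of_isHaarMeasure ν' (νU.prod νK)).ne'
  have hν'_apply : ∀ (E : Set U) (F : Set K), νG (eM ⁻¹' (E ×ˢ F)) = m * (νU E * νK F) := by
    intro E F
    have h1 : νG (eM ⁻¹' (E ×ˢ F)) = ν' (E ×ˢ F) := by
      rw [hν'_def, show Measure.map (⇑e) νG = Measure.map (⇑eM.toHomeomorph.toMeasurableEquiv) νG from rfl, MeasurableEquiv.map_apply]
      rfl
    rw [h1, hm, Measure.smul_apply, Measure.prod_prod, ENNReal.smul_def, smul_eq_mul]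
  -- (e) transport + scaling + product + collapse of the `⊤`-factor
  have hTr := map_cosetCongr_quotientMeasure e he hes T (A.prod (⊤ : Subgroup K)) hHH' ρT ρT' νG ν' rfl rfl
  have hsc := quotientMeasure_eq_div_smul_of_eq_smul (A.prod (⊤ : Subgroup K)) hT'c ρp ρT' (νU.prod νK) ν' hd0 hm0 hd hm
  have hpr := map_quotientProdHomeomorph_quotientMeasure_prod A (⊤ : Subgroup K) ρA ρK ρp hρp νU νK
  have htop : quotientMeasure (⊤ : Subgroup K) ρK hKc νK Set.univ = 1 := quotientMeasure_top_univ νK ρK hρK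
  haveI : IsFiniteMeasure (quotientMeasure (⊤ : Subgroup K) ρK hKc νK) := ⟨by rw [htop]; exact ENNReal.one_lt_top⟩
  -- `Ψ` in block coordinates
  have hΨfun : (Ψ : G ⧸ T → U ⧸ A) =
      Prod.fst ∘ (quotientProdHomeomorph A (⊤ : Subgroup K)) ∘ (cosetCongr e T (A.prod (⊤ : Subgroup K)) hHH') :=
    funext fun x => map_block_eq_fst eM T A hTA Ψ hΨ hHH' x
  have hcc : Measurable (cosetCongr e T (A.prod (⊤ : Subgroup K)) hHH') := (continuous_cosetCongr e T _ hHH' he).measurable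
  have hq : Measurable (quotientProdHomeomorph A (⊤ : Subgroup K)) := (quotientProdHomeomorph A (⊤ : Subgroup K)).continuous.measurable
  refine ⟨m / d, div_ne_zero hm0 hd0, ?_, ?_⟩
  · rw [hΨfun, ← Measure.map_map measurable_fst (hq.comp hcc), ← Measure.map_map hq hcc, hTr, hsc, Measure.map_smul, Measure.map_smul, hpr, Measure.map_fst_prod,
      htop, one_smul, ENNReal.smul_def]
  · intro E E' F
    rw [hρT'_apply, hν'_apply]
    have hcd : ((m / d : ℝ≥0) : ℝ≥0∞) * (d : ℝ≥0∞) = m := by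
      rw [← ENNReal.coe_mul, div_mul_cancel₀ _ hd0]
    calc ((m / d : ℝ≥0) : ℝ≥0∞) * (↑d * (ρA (Subtype.val ⁻¹' E') * νK F)) * νU E
        = (((m / d : ℝ≥0) : ℝ≥0∞) * ↑d) * (ρA (Subtype.val ⁻¹' E') * νK F) * νU E := by ring
      _ = ↑m * (νU E * νK F) * ρA (Subtype.val ⁻¹' E') := by rw [hcd]; ring

include hTA hΨ hA ρA in
/-- **COMPACT FACTOR: THE `hmap` SHAPE OF ★ p850417.**  If `A` is compact, `Ψ_* (ν_G ∕ ρ_T) = κ • π_* ν_U` (`π : U → U ⧸ A`) for ONE `κ > 0`, PINNED by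
**`κ · ρ_T{t ∣ (eM t).2 ∈ F} · ν_U(E) = ν_G(eM⁻¹(E × F))`** for all `E ⊆ U`, `F ⊆ K` — no measure on `A` appears (`ν_U ∕ ρ_A = ρ_A(A)⁻¹ • π_* ν_U`, ★ `quotientMeasure_eq_inv_smul_map_mk`).
[cite: Folland1995, §2.6 Thm. 2.49, (2.52)] [cite: DeitmarEchterhoff2014, Cor. 1.5.4] [cite: Rogawski1990, §8.2 p. 122] -/
theorem exists_smul_map_mk_of_block_compact (νK : Measure K) [νK.IsHaarMeasure] [νK.IsMulRightInvariant] [νK.IsInvInvariant] [CompactSpace A] :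
    ∃ κ : ℝ≥0, κ ≠ 0 ∧
      Measure.map Ψ (quotientMeasure T ρT hT νG) = κ • Measure.map (QuotientGroup.mk : U → U ⧸ A) νU ∧
      ∀ (E : Set U) (F : Set K), (κ : ℝ≥0∞) * ρT {t : T | (eM (t : G)).2 ∈ F} * νU E = νG (eM ⁻¹' (E ×ˢ F)) := by
  haveI : IsClosed (A : Set U) := hA
  obtain ⟨c, hc0, hmap, hpin⟩ := exists_smul_map_block_quotientMeasure eM T hT A hA hTA Ψ hΨ ρT νG ρA νU νK
  have hA0 : ρA Set.univ ≠ 0 := (isOpen_univ.measure_pos ρA Set.univ_nonempty).ne'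
  have hAt : ρA Set.univ ≠ ⊤ := (isCompact_univ.measure_lt_top (μ := ρA)).ne
  have hAnn : (ρA Set.univ).toNNReal ≠ 0 := fun h => by
    rcases (ENNReal.toNNReal_eq_zero_iff _).1 h with h' | h'
    exacts [hA0 h', hAt h']
  refine ⟨c / (ρA Set.univ).toNNReal, div_ne_zero hc0 hAnn, ?_, fun E F => ?_⟩
  · rw [hmap, quotientMeasure_eq_inv_smul_map_mk A ρA νU, ENNReal.smul_def, smul_smul, ENNReal.smul_def, ENNReal.coe_div hAnn, ENNReal.coe_toNNReal hAt,
      div_eq_mul_inv]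
  · have h := hpin E Set.univ F
    have hset : {t : T | (eM (t : G)).1 ∈ (Set.univ : Set U) ∧ (eM (t : G)).2 ∈ F} = {t : T | (eM (t : G)).2 ∈ F} := by
      ext t; simp only [Set.mem_univ, true_and, Set.mem_setOf_eq]
    rw [hset, Set.preimage_univ] at h
    -- divide the pinning identity by `ρ_A(A)`
    have hcκ : (c : ℝ≥0∞) = ((c / (ρA Set.univ).toNNReal : ℝ≥0) : ℝ≥0∞) * ρA Set.univ := by
      rw [ENNReal.coe_div hAnn, ENNReal.coe_toNNReal hAt, ENNReal.div_mul_cancel hA0 hAt]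
    rw [hcκ] at h
    have h' : ρA Set.univ * (((c / (ρA Set.univ).toNNReal : ℝ≥0) : ℝ≥0∞) * ρT {t : T | (eM (t : G)).2 ∈ F} * νU E) =
        ρA Set.univ * νG (eM ⁻¹' (E ×ˢ F)) := by
      rw [mul_comm (νG _) (ρA _)] at h
      rw [← h]; ring
    exact (ENNReal.mul_right_inj hA0 hAt).mp h'

include hTA hΨ in
/-- **BOX-NORMALISED TARGET: THE `hmapβ` SHAPE OF ★ p850444 WITH LH4-p03's `hlink`.**  For any measure `μ′ = ρ_A(E₀ ∩ A) • (ν_U ∕ ρ_A)` (`0 < ρ_A(E₀ ∩ A) < ∞`; e.g. the shared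
`μ₀′ = ρ(B_std) • (μ₀ ∕ ρ)` on `U(J) ⧸ T_split`, Haar-free in `ρ`): `Ψ_* (ν_G ∕ ρ_T) = κ • μ′` for ONE `κ > 0`, PINNED by
**`κ · ρ_T{t ∣ (eM t).1 ∈ E₀ ∧ (eM t).2 ∈ F} · ν_U(E) = ν_G(eM⁻¹(E × F))`** for all `E ⊆ U`, `F ⊆ K` — again `ρ_A`-free. [cite: Folland1995, §2.6 (2.52)] [cite: DeitmarEchterhoff2014, Thm. 1.5.3]
[cite: Rogawski1990, §8.2 p. 122] -/
theorem exists_smul_eq_of_block_boxNormalised (νK : Measure K) [νK.IsHaarMeasure] [νK.IsMulRightInvariant] [νK.IsInvInvariant] (E₀ : Set U) (h0 : ρA (Subtype.val ⁻¹' E₀) ≠ 0) (htop : ρA (Subtype.val ⁻¹' E₀) ≠ ⊤)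
    (μ' : Measure (U ⧸ A)) (hμ' : μ' = ρA (Subtype.val ⁻¹' E₀) • quotientMeasure A ρA hA νU) :
    ∃ κ : ℝ≥0, κ ≠ 0 ∧
      Measure.map Ψ (quotientMeasure T ρT hT νG) = κ • μ' ∧
      ∀ (E : Set U) (F : Set K), (κ : ℝ≥0∞) * ρT {t : T | (eM (t : G)).1 ∈ E₀ ∧ (eM (t : G)).2 ∈ F} * νU E = νG (eM ⁻¹' (E ×ˢ F)) := by
  obtain ⟨c, hc0, hmap, hpin⟩ := exists_smul_map_block_quotientMeasure eM T hT A hA hTA Ψ hΨ ρT νG ρA νU νK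
  have hnn : (ρA (Subtype.val ⁻¹' E₀)).toNNReal ≠ 0 := fun h => by
    rcases (ENNReal.toNNReal_eq_zero_iff _).1 h with h' | h'
    exacts [h0 h', htop h']
  refine ⟨c / (ρA (Subtype.val ⁻¹' E₀)).toNNReal, div_ne_zero hc0 hnn, ?_, fun E F => ?_⟩
  · rw [hmap, hμ', ENNReal.smul_def, ENNReal.smul_def, smul_smul, ENNReal.coe_div hnn, ENNReal.coe_toNNReal htop, ENNReal.div_mul_cancel h0 htop]
  · have h := hpin E E₀ F
    have hcκ : (c : ℝ≥0∞) = ((c / (ρA (Subtype.val ⁻¹' E₀)).toNNReal : ℝ≥0) : ℝ≥0∞) * ρA (Subtype.val ⁻¹' E₀) := by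
      rw [ENNReal.coe_div hnn, ENNReal.coe_toNNReal htop, ENNReal.div_mul_cancel h0 htop]
    rw [hcκ] at h
    have h' : ρA (Subtype.val ⁻¹' E₀) * (((c / (ρA (Subtype.val ⁻¹' E₀)).toNNReal : ℝ≥0) : ℝ≥0∞) *
        ρT {t : T | (eM (t : G)).1 ∈ E₀ ∧ (eM (t : G)).2 ∈ F} * νU E) = ρA (Subtype.val ⁻¹' E₀) * νG (eM ⁻¹' (E ×ˢ F)) := by
      rw [mul_comm (νG _) (ρA _)] at h
      rw [← h]; ring
    exact (ENNReal.mul_right_inj h0 htop).mp h'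

end Block

/-! ### §3 Two descents of the same measure through the same block equivalence have the same descent constant -/

section TwoDescents

/-- **`K = Kβ`** (organ J of `stub_N9`, LH3-p02 (g3) ED. 3): if two chart tori `T₁, T₂ ≤ G` descend the SAME `ν_G` through the SAME `eM` with pinned scalars `κ₁, κ₂`
(`κ_i · ρ_{T_i}(B_i) · ν_U(E) = ν_G(eM⁻¹(E × F))` for the two chart boxes `B₁ ⊆ T₁`, `B₂ ⊆ T₂` having the SAME `K`-shadow `F`, read at one set `E` of finite positive
`ν_U`-mass), then the two descent constants agree: `ρ_{T₁}(B₁) · κ₁ = ρ_{T₂}(B₂) · κ₂` (as real numbers, the currency of ★ `chartOrbG`'s prefactor `dt′(B′)`).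
[cite: Rogawski1990, §8.2 p. 122] [cite: Folland1995, §2.6 (2.52)] -/
theorem toReal_mul_eq_toReal_mul_of_pinning {κ₁ κ₂ : ℝ≥0} {b₁ b₂ v n : ℝ≥0∞}
    (h₁ : (κ₁ : ℝ≥0∞) * b₁ * v = n) (h₂ : (κ₂ : ℝ≥0∞) * b₂ * v = n) (hv0 : v ≠ 0) (hv : v ≠ ⊤) :
    b₁.toReal * (κ₁ : ℝ) = b₂.toReal * (κ₂ : ℝ) := by
  have h : (κ₁ : ℝ≥0∞) * b₁ = (κ₂ : ℝ≥0∞) * b₂ := by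
    have h3 : (κ₁ : ℝ≥0∞) * b₁ * v = (κ₂ : ℝ≥0∞) * b₂ * v := by rw [h₁, h₂]
    exact (ENNReal.mul_left_inj hv0 hv).mp h3
  have h' := congrArg ENNReal.toReal h
  rw [ENNReal.toReal_mul, ENNReal.toReal_mul, ENNReal.coe_toReal, ENNReal.coe_toReal] at h'
  linarith [h']

end TwoDescents

end Literature.MeasureTheory.Group

end
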